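import Summits.AtomisticToContinuum.Crystallization.Theorems.HullExactificationCascadeZeroDefectDensityCapAtomsAux
import Summits.AtomisticToContinuum.Crystallization.Theorems.HullExactificationCascadeZeroDefectDensityPinsPattern
import HarnessLib

/-!
# Pins: the `√2`, `√3`, `√(8/3)` pairs of a softly kissed fcc/hcp shell are pinned (birth line of `ZeroDefectDensity`, stub `stub_pins`)
# (route `HullExactificationCascade`, crux `ZeroDefectDensity`, stmt-AtomisticToContinuum-12086; lead c4)

The registered stub `stub_pins` of `Cruxes/ZeroDefectDensity/Lines/birth.lean`, verbatim: under
two-shell `1/4000`-soft kissing about `u ∈ S`, with the `1/400`-soft shell of `u` in bijection `e` with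
the fcc or the hcp kissing pattern so that soft contact is pattern contact, and given as hypotheses
(i) caps on induced soft 4-cycles (the conclusion of `stub_capAtoms`), (ii) the squared octahedron
lemma (`oct_sq_bounds`), (iii) both halves of the quantitative link lemma (`stub_linkQ`): every pair of
shell points whose pattern images are at distance `√2` satisfies `|d² - 2| ≤ 38/4000`, at distance `√3`
`|d² - 3| ≤ 40/4000`, at distance `√(8/3)` (hcp only; vacuous for fcc) `|d² - 8/3| ≤ 60/4000`.

Setting of the helper theorems (as in `…CapAtomsAux`, whose bookkeeping is reused): two-shell
`1/4000`-soft kissing about `u ∈ S` (`hsep`), and a CHART `idx : shell(u) ≃ Fin 12` of the `1/400`-soft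
shell of `u` turning soft contact into an abstract irreflexive symmetric relation `adj` on `Fin 12`
(`hidx`); the three metric lemmas are hypotheses.

* `chart_sq2_pin` — the diagonal `(i, j)` of an induced 4-cycle `i ~ k ~ j ~ l ~ i` of the chart such
  that no label is adjacent to `i`, `j` and `k` satisfies `|d² - 2| ≤ 38/4000`: the cap `w` of the soft
  4-cycle is a soft contact of the four corners, is not a first-shell point (else its label would be
  adjacent to `i, j, k`), hence `dist u w ≥ 131/100`, and `u, w, z_i, z_k, z_j, z_l` is a soft
  octahedron.
* `chart_linkA_pin`, `chart_linkB_pin` — the quantitative link lemma read through the chart: at a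
  label `c` with neighbours `n₁ n₂ n₃ n₄` in type-A position (`n₁ ~ n₂`, `n₃ ~ n₄`, `(n₂,n₃)`, `(n₄,n₁)`
  pinned squares, `(n₁,n₃)`, `(n₂,n₄)` non-adjacent) both far pairs are `|d² - 3| ≤ 40/4000`; in type-B
  position (`n₁ ~ n₂ ~ n₃`, `(n₃,n₄)`, `(n₄,n₁)` pinned squares) `|d(n₁,n₃)² - 8/3| ≤ 60/4000` and
  `|d(n₂,n₄)² - 3| ≤ 40/4000`.
* `chart_pins` — for abstract pair-predicates `Sq2`, `Sq3`, `Sq83` on labels satisfying the four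
  pattern facts of `…PinsPattern` (every `Sq2` pair spans an induced 4-cycle, two common neighbours of
  an `Sq2` pair are non-adjacent, every `Sq3` pair sits in a type-A or type-B link, every `Sq83` pair is
  the two-contact pair of a type-B link), all `Sq2` pairs are pinned to `38/4000`, all `Sq3` pairs to
  `40/4000`, all `Sq83` pairs to `60/4000`.
* `stub_pins` — compose `e` with the full chart of the pattern (`fcc_chart_full` / `hcp_chart_full`)
  to label the shell by `Fin 12` with soft contact = `fccAdj` / `hcpAdj` and pattern distances
  `√2, √3, √(8/3)` = integer conditions on the tables, and feed the pattern facts to `chart_pins`.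

Pure metric bookkeeping at `η = 1/4000` plus glue; no new definitions. [folklore]
-/

noncomputable section

namespace Summit.AtomisticToContinuum.Crystallization.Theorems.ZeroDefectDensityBirth

open Literature.Geometry.DiscreteGeometry

/-- **The diagonal of a capped soft square is pinned.** In a charted soft shell of `u` (soft kissing,
caps on induced soft 4-cycles, the squared octahedron lemma): if `i ~ k ~ j ~ l ~ i` with `i ≁ j`,
`k ≁ l` distinct, and no label is adjacent to `i`, `j` and `k`, then `|dist(z_i, z_j)² - 2| ≤ 38/4000`.
The cap `w` of the 4-cycle is `1/4000`-close to the four corners, distinct from them (opposite corners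
are `≥ 131/100` apart), at distance `≥ 1 - 1/4000` from them (soft kissing at the corners) and
`≥ 131/100` from `u` (a soft contact of `u` would be a shell point whose label is adjacent to
`i, j, k`); the octahedron lemma at `η = 1/4000` pins the equatorial diagonal. [folklore] -/
theorem chart_sq2_pin {S : Set (EuclideanSpace ℝ (Fin 3))} {u : EuclideanSpace ℝ (Fin 3)} {adj : Fin 12 → Fin 12 → Prop}
    (hsep : ∀ v ∈ S, dist u v ≤ 13 / 5 → ∀ w ∈ S, w ≠ v → 1 - 1 / 4000 ≤ dist v w ∧ (dist v w ≤ 1 + 1 / 4000 ∨ 131 / 100 ≤ dist v w))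
    (hu : u ∈ S) (idx : {w : EuclideanSpace ℝ (Fin 3) // w ∈ S ∧ w ≠ u ∧ dist u w ≤ 1 + 1 / 400} ≃ Fin 12)
    (hidx : ∀ w w' : {w : EuclideanSpace ℝ (Fin 3) // w ∈ S ∧ w ≠ u ∧ dist u w ≤ 1 + 1 / 400}, w ≠ w' → (dist w.1 w'.1 ≤ 1 + 1 / 400 ↔ adj (idx w) (idx w')))
    (hirr : ∀ i : Fin 12, ¬ adj i i)
    (hcap : ∀ z₁ ∈ S, ∀ z₂ ∈ S, ∀ z₃ ∈ S, ∀ z₄ ∈ S, z₁ ≠ u → z₂ ≠ u → z₃ ≠ u → z₄ ≠ u → dist u z₁ ≤ 1 + 1 / 4000 → dist u z₂ ≤ 1 + 1 / 4000 → dist u z₃ ≤ 1 + 1 / 4000 → dist u z₄ ≤ 1 + 1 / 4000 → dist z₁ z₂ ≤ 1 + 1 / 4000 → dist z₂ z₃ ≤ 1 + 1 / 4000 → dist z₃ z₄ ≤ 1 + 1 / 4000 → dist z₄ z₁ ≤ 1 + 1 / 4000 → ¬ dist z₁ z₃ ≤ 1 + 1 / 4000 → ¬ dist z₂ z₄ ≤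 1 + 1 / 4000 → ∃ w ∈ S, w ≠ u ∧ dist w z₁ ≤ 1 + 1 / 4000 ∧ dist w z₂ ≤ 1 + 1 / 4000 ∧ dist w z₃ ≤ 1 + 1 / 4000 ∧ dist w z₄ ≤ 1 + 1 / 4000)
    (hoct : ∀ (η : ℝ) (u w z₁ z₂ z₃ z₄ : EuclideanSpace ℝ (Fin 3)), 0 ≤ η → η ≤ 1 / 1000 → 1 - η ≤ dist u z₁ → dist u z₁ ≤ 1 + η → 1 - η ≤ dist u z₂ → dist u z₂ ≤ 1 + η → 1 - η ≤ dist u z₃ → dist u z₃ ≤ 1 + η → 1 - η ≤ dist u z₄ → dist u z₄ ≤ 1 + η → 1 - η ≤ dist w z₁ → dist w z₁ ≤ 1 + η → 1 - η ≤ dist w z₂ → dist w z₂ ≤ 1 + η → 1 - η ≤ dist w z₃ → dist w z₃ ≤ 1 + η → 1 - η ≤ dist w z₄ → dist w z₄ ≤ 1 + η → 1 - η ≤ dist z₁ z₂ → dist z₁ z₂ ≤ 1 + η → 1 - η ≤ dist z₂ z₃ → dist z₂ z₃ ≤ 1 + η → 1 - η ≤ dist z₃ z₄ → dist z₃ z₄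 ≤ 1 + η → 1 - η ≤ dist z₄ z₁ → dist z₄ z₁ ≤ 1 + η → 131 / 100 ≤ dist z₁ z₃ → 131 / 100 ≤ dist z₂ z₄ → 131 / 100 ≤ dist u w → |dist z₁ z₃ ^ 2 - 2| ≤ 38 * η ∧ |dist z₂ z₄ ^ 2 - 2| ≤ 38 * η ∧ |dist u w ^ 2 - 2| ≤ 29 * η)
    {i k j l : Fin 12} (hik : adj i k) (hkj : adj k j) (hjl : adj j l) (hli : adj l i)
    (hij : ¬ adj i j) (hkl : ¬ adj k l) (hij' : i ≠ j) (hkl' : k ≠ l)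
    (hC : ∀ m : Fin 12, adj m i → adj m j → adj m k → False) :
    |dist (idx.symm i).1 (idx.symm j).1 ^ 2 - 2| ≤ 38 / 4000 := by
  have hup : dist u u ≤ 11 / 10 := by rw [dist_self]; norm_num
  have AB := chart_apex_band hsep hu hup
  have CB : ∀ {a b : Fin 12}, adj a b →
      1 - 1 / 4000 ≤ dist (idx.symm a).1 (idx.symm b).1 ∧ dist (idx.symm a).1 (idx.symm b).1 ≤ 1 + 1 / 4000 :=
    fun h => chart_adj_band hsep hup idx hidx hirr h
  have FR : ∀ {a b : Fin 12}, a ≠ b → ¬ adj a b → 131 / 100 ≤ dist (idx.symm a).1 (idx.symm b).1 :=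
    fun h h' => chart_far hsep hup idx hidx h h'
  have hi := AB (idx.symm i)
  have hk := AB (idx.symm k)
  have hj := AB (idx.symm j)
  have hl := AB (idx.symm l)
  have dik := CB hik
  have dkj := CB hkj
  have djl := CB hjl
  have dli := CB hli
  have fij := FR hij' hij
  have fkl := FR hkl' hkl
  obtain ⟨w, hwS, hwu, hw1, hw2, hw3, hw4⟩ := hcap (idx.symm i).1 (idx.symm i).2.1 (idx.symm k).1
    (idx.symm k).2.1 (idx.symm j).1 (idx.symm j).2.1 (idx.symm l).1 (idx.symm l).2.1
    (idx.symm i).2.2.1 (idx.symm k).2.2.1 (idx.symm j).2.2.1 (idx.symm l).2.2.1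
    hi.2 hk.2 hj.2 hl.2 dik.2 dkj.2 djl.2 dli.2 (fun h => by linarith) (fun h => by linarith)
  -- the cap is none of the four corners
  have hwi : w ≠ (idx.symm i).1 := by
    rintro rfl
    linarith
  have hwj : w ≠ (idx.symm j).1 := by
    rintro rfl
    rw [dist_comm] at hw1
    linarith
  have hwk : w ≠ (idx.symm k).1 := by
    rintro rfl
    linarith
  have hwl : w ≠ (idx.symm l).1 := by
    rintro rfl
    rw [dist_comm] at hw2
    linarith
  -- soft kissing at the corners: the cap is at distance `≥ 1 - 1/4000` from each
  have lw : ∀ t : {w : EuclideanSpace ℝ (Fin 3) // w ∈ S ∧ w ≠ u ∧ dist u w ≤ 1 + 1 / 400}, w ≠ t.1 →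
      1 - 1 / 4000 ≤ dist w t.1 := fun t ht => by
    rw [dist_comm]
    exact soft_lower hsep t.2.1 (chart_dist_u hup t) hwS ht
  -- the cap is not a soft contact of `u`
  have hwfar : 131 / 100 ≤ dist u w := by
    refine soft_far hsep hu (by rw [dist_self]; norm_num) hwS hwu (fun hle => ?_)
    have hle' : dist u w ≤ 1 + 1 / 400 := by linarith
    have am : ∀ t : {w : EuclideanSpace ℝ (Fin 3) // w ∈ S ∧ w ≠ u ∧ dist u w ≤ 1 + 1 / 400}, w ≠ t.1 →
        dist w t.1 ≤ 1 + 1 / 4000 → adj (idx ⟨w, hwS, hwu, hle'⟩) (idx t) := fun t ht hd =>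
      (hidx ⟨w, hwS, hwu, hle'⟩ t (fun h => ht (congrArg Subtype.val h))).1
        (hd.trans (by norm_num))
    have ai := am (idx.symm i) hwi hw1
    have aj := am (idx.symm j) hwj hw3
    have ak := am (idx.symm k) hwk hw2
    rw [Equiv.apply_symm_apply] at ai aj ak
    exact hC _ ai aj ak
  have O := hoct (1 / 4000) u w (idx.symm i).1 (idx.symm k).1 (idx.symm j).1 (idx.symm l).1
    (by norm_num) (by norm_num) hi.1 hi.2 hk.1 hk.2 hj.1 hj.2 hl.1 hl.2
    (lw _ hwi) hw1 (lw _ hwk) hw2 (lw _ hwj) hw3 (lw _ hwl) hw4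
    dik.1 dik.2 dkj.1 dkj.2 djl.1 djl.2 dli.1 dli.2 fij fkl hwfar
  linarith [O.1]

/-- **Type-A links are pinned** (the quantitative link lemma, type `(3,4,3,4)`, read through the
chart): at a label `c` with neighbours `n₁ ~ n₂`, `n₃ ~ n₄`, squares `(n₂,n₃)`, `(n₄,n₁)` already pinned
to `38/4000` and `(n₁,n₃)`, `(n₂,n₄)` distinct non-adjacent, both far pairs satisfy
`|d² - 3| ≤ 40/4000`. [folklore] -/
theorem chart_linkA_pin {S : Set (EuclideanSpace ℝ (Fin 3))} {u : EuclideanSpace ℝ (Fin 3)} {adj : Fin 12 → Fin 12 → Prop}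
    (hsep : ∀ v ∈ S, dist u v ≤ 13 / 5 → ∀ w ∈ S, w ≠ v → 1 - 1 / 4000 ≤ dist v w ∧ (dist v w ≤ 1 + 1 / 4000 ∨ 131 / 100 ≤ dist v w))
    (hu : u ∈ S) (idx : {w : EuclideanSpace ℝ (Fin 3) // w ∈ S ∧ w ≠ u ∧ dist u w ≤ 1 + 1 / 400} ≃ Fin 12)
    (hidx : ∀ w w' : {w : EuclideanSpace ℝ (Fin 3) // w ∈ S ∧ w ≠ u ∧ dist u w ≤ 1 + 1 / 400}, w ≠ w' → (dist w.1 w'.1 ≤ 1 + 1 / 400 ↔ adj (idx w) (idx w')))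
    (hirr : ∀ i : Fin 12, ¬ adj i i)
    (hlqa : ∀ (η : ℝ) (p c n₁ n₂ n₃ n₄ : EuclideanSpace ℝ (Fin 3)), 0 ≤ η → η ≤ 1 / 1000 → 1 - η ≤ dist c p → dist c p ≤ 1 + η → 1 - η ≤ dist p n₁ → dist p n₁ ≤ 1 + η → 1 - η ≤ dist p n₂ → dist p n₂ ≤ 1 + η → 1 - η ≤ dist p n₃ → dist p n₃ ≤ 1 + η → 1 - η ≤ dist p n₄ → dist p n₄ ≤ 1 + η → 1 - η ≤ dist c n₁ → dist c n₁ ≤ 1 + η → 1 - η ≤ dist c n₂ → dist c n₂ ≤ 1 + η → 1 - η ≤ dist c n₃ → dist c n₃ ≤ 1 + η → 1 - η ≤ dist c n₄ → dist c n₄ ≤ 1 + η → 1 - η ≤ dist n₁ n₂ → dist n₁ n₂ ≤ 1 + η → 1 - η ≤ dist n₃ n₄ → dist n₃ n₄ ≤ 1 + η → |dist n₂ n₃ ^ 2 - 2| ≤ 38 * η → |dist n₄ n₁ ^ 2 - 2| ≤ 38 * η → 131 / 100 ≤ dist n₁ n₃ → 131 / 100 ≤ dist n₂ n₄ → |dist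 n₁ n₃ ^ 2 - 3| ≤ 40 * η ∧ |dist n₂ n₄ ^ 2 - 3| ≤ 40 * η)
    {c n₁ n₂ n₃ n₄ : Fin 12} (hc1 : adj c n₁) (hc2 : adj c n₂) (hc3 : adj c n₃) (hc4 : adj c n₄)
    (h12 : adj n₁ n₂) (h34 : adj n₃ n₄)
    (s23 : |dist (idx.symm n₂).1 (idx.symm n₃).1 ^ 2 - 2| ≤ 38 / 4000)
    (s41 : |dist (idx.symm n₄).1 (idx.symm n₁).1 ^ 2 - 2| ≤ 38 / 4000)
    (h13 : ¬ adj n₁ n₃) (h13' : n₁ ≠ n₃) (h24 : ¬ adj n₂ n₄) (h24' : n₂ ≠ n₄) :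
    |dist (idx.symm n₁).1 (idx.symm n₃).1 ^ 2 - 3| ≤ 40 / 4000 ∧
      |dist (idx.symm n₂).1 (idx.symm n₄).1 ^ 2 - 3| ≤ 40 / 4000 := by
  have hup : dist u u ≤ 11 / 10 := by rw [dist_self]; norm_num
  have AB := chart_apex_band hsep hu hup
  have CB : ∀ {a b : Fin 12}, adj a b →
      1 - 1 / 4000 ≤ dist (idx.symm a).1 (idx.symm b).1 ∧ dist (idx.symm a).1 (idx.symm b).1 ≤ 1 + 1 / 4000 :=
    fun h => chart_adj_band hsep hup idx hidx hirr h
  have FR : ∀ {a b : Fin 12}, a ≠ b → ¬ adj a b → 131 / 100 ≤ dist (idx.symm a).1 (idx.symm b).1 :=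
    fun h h' => chart_far hsep hup idx hidx h h'
  have hcp := AB (idx.symm c)
  have hp1 := AB (idx.symm n₁)
  have hp2 := AB (idx.symm n₂)
  have hp3 := AB (idx.symm n₃)
  have hp4 := AB (idx.symm n₄)
  have hc1' := CB hc1
  have hc2' := CB hc2
  have hc3' := CB hc3
  have hc4' := CB hc4
  have h12' := CB h12
  have h34' := CB h34
  have f13 := FR h13' h13
  have f24 := FR h24' h24
  have L := hlqa (1 / 4000) u (idx.symm c).1 (idx.symm n₁).1 (idx.symm n₂).1 (idx.symm n₃).1
    (idx.symm n₄).1 (by norm_num) (by norm_num)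
    (by rw [dist_comm]; exact hcp.1) (by rw [dist_comm]; exact hcp.2)
    hp1.1 hp1.2 hp2.1 hp2.2 hp3.1 hp3.2 hp4.1 hp4.2
    hc1'.1 hc1'.2 hc2'.1 hc2'.2 hc3'.1 hc3'.2 hc4'.1 hc4'.2
    h12'.1 h12'.2 h34'.1 h34'.2 (by linarith [s23]) (by linarith [s41]) f13 f24
  exact ⟨by linarith [L.1], by linarith [L.2]⟩

/-- **Type-B links are pinned** (the quantitative link lemma, type `(3,3,4,4)`, read through the
chart): at a label `c` with neighbours `n₁ ~ n₂ ~ n₃`, squares `(n₃,n₄)`, `(n₄,n₁)` already pinned to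
`38/4000` and `(n₁,n₃)`, `(n₂,n₄)` distinct non-adjacent, `|d(n₁,n₃)² - 8/3| ≤ 60/4000` and
`|d(n₂,n₄)² - 3| ≤ 40/4000`. [folklore] -/
theorem chart_linkB_pin {S : Set (EuclideanSpace ℝ (Fin 3))} {u : EuclideanSpace ℝ (Fin 3)} {adj : Fin 12 → Fin 12 → Prop}
    (hsep : ∀ v ∈ S, dist u v ≤ 13 / 5 → ∀ w ∈ S, w ≠ v → 1 - 1 / 4000 ≤ dist v w ∧ (dist v w ≤ 1 + 1 / 4000 ∨ 131 / 100 ≤ dist v w))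
    (hu : u ∈ S) (idx : {w : EuclideanSpace ℝ (Fin 3) // w ∈ S ∧ w ≠ u ∧ dist u w ≤ 1 + 1 / 400} ≃ Fin 12)
    (hidx : ∀ w w' : {w : EuclideanSpace ℝ (Fin 3) // w ∈ S ∧ w ≠ u ∧ dist u w ≤ 1 + 1 / 400}, w ≠ w' → (dist w.1 w'.1 ≤ 1 + 1 / 400 ↔ adj (idx w) (idx w')))
    (hirr : ∀ i : Fin 12, ¬ adj i i)
    (hlqb : ∀ (η : ℝ) (p c n₁ n₂ n₃ n₄ : EuclideanSpace ℝ (Fin 3)), 0 ≤ η → η ≤ 1 / 1000 → 1 - η ≤ dist c p → dist c p ≤ 1 + η → 1 - η ≤ dist p n₁ → dist p n₁ ≤ 1 + η → 1 - η ≤ dist p n₂ → dist p n₂ ≤ 1 + η → 1 - η ≤ dist p n₃ → dist p n₃ ≤ 1 + η → 1 - η ≤ dist p n₄ → dist p n₄ ≤ 1 + η → 1 - η ≤ dist c n₁ → dist c n₁ ≤ 1 + η → 1 - η ≤ dist c n₂ → dist c n₂ ≤ 1 + η → 1 - η ≤ dist c n₃ → dist c n₃ ≤ 1 + η → 1 -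 η ≤ dist c n₄ → dist c n₄ ≤ 1 + η → 1 - η ≤ dist n₁ n₂ → dist n₁ n₂ ≤ 1 + η → 1 - η ≤ dist n₂ n₃ → dist n₂ n₃ ≤ 1 + η → |dist n₃ n₄ ^ 2 - 2| ≤ 38 * η → |dist n₄ n₁ ^ 2 - 2| ≤ 38 * η → 131 / 100 ≤ dist n₁ n₃ → 131 / 100 ≤ dist n₂ n₄ → |dist n₁ n₃ ^ 2 - 8 / 3| ≤ 60 * η ∧ |dist n₂ n₄ ^ 2 - 3| ≤ 40 * η)
    {c n₁ n₂ n₃ n₄ : Fin 12} (hc1 : adj c n₁) (hc2 : adj c n₂) (hc3 : adj c n₃) (hc4 : adj c n₄)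
    (h12 : adj n₁ n₂) (h23 : adj n₂ n₃)
    (s34 : |dist (idx.symm n₃).1 (idx.symm n₄).1 ^ 2 - 2| ≤ 38 / 4000)
    (s41 : |dist (idx.symm n₄).1 (idx.symm n₁).1 ^ 2 - 2| ≤ 38 / 4000)
    (h13 : ¬ adj n₁ n₃) (h13' : n₁ ≠ n₃) (h24 : ¬ adj n₂ n₄) (h24' : n₂ ≠ n₄) :
    |dist (idx.symm n₁).1 (idx.symm n₃).1 ^ 2 - 8 / 3| ≤ 60 / 4000 ∧
      |dist (idx.symm n₂).1 (idx.symm n₄).1 ^ 2 - 3| ≤ 40 / 4000 := by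
  have hup : dist u u ≤ 11 / 10 := by rw [dist_self]; norm_num
  have AB := chart_apex_band hsep hu hup
  have CB : ∀ {a b : Fin 12}, adj a b →
      1 - 1 / 4000 ≤ dist (idx.symm a).1 (idx.symm b).1 ∧ dist (idx.symm a).1 (idx.symm b).1 ≤ 1 + 1 / 4000 :=
    fun h => chart_adj_band hsep hup idx hidx hirr h
  have FR : ∀ {a b : Fin 12}, a ≠ b → ¬ adj a b → 131 / 100 ≤ dist (idx.symm a).1 (idx.symm b).1 :=
    fun h h' => chart_far hsep hup idx hidx h h'
  have hcp := AB (idx.symm c)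
  have hp1 := AB (idx.symm n₁)
  have hp2 := AB (idx.symm n₂)
  have hp3 := AB (idx.symm n₃)
  have hp4 := AB (idx.symm n₄)
  have hc1' := CB hc1
  have hc2' := CB hc2
  have hc3' := CB hc3
  have hc4' := CB hc4
  have h12' := CB h12
  have h23' := CB h23
  have f13 := FR h13' h13
  have f24 := FR h24' h24
  have L := hlqb (1 / 4000) u (idx.symm c).1 (idx.symm n₁).1 (idx.symm n₂).1 (idx.symm n₃).1
    (idx.symm n₄).1 (by norm_num) (by norm_num)
    (by rw [dist_comm]; exact hcp.1) (by rw [dist_comm]; exact hcp.2)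
    hp1.1 hp1.2 hp2.1 hp2.2 hp3.1 hp3.2 hp4.1 hp4.2
    hc1'.1 hc1'.2 hc2'.1 hc2'.2 hc3'.1 hc3'.2 hc4'.1 hc4'.2
    h12'.1 h12'.2 h23'.1 h23'.2 (by linarith [s34]) (by linarith [s41]) f13 f24
  exact ⟨by linarith [L.1], by linarith [L.2]⟩

/-- **All pattern pairs of a charted soft shell are pinned.** For pair-predicates `Sq2`, `Sq3`,
`Sq83` on labels such that every `Sq2` pair is the diagonal of an induced 4-cycle, two common
neighbours of an `Sq2` pair are never adjacent, every `Sq3` pair sits in a type-A or a type-B link (in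
one of two orientations) and every `Sq83` pair is the two-contact pair of a type-B link — the pattern
facts of `…PinsPattern` for fcc and hcp — the caps, the squared octahedron lemma and the quantitative
link lemma pin every `Sq2` pair to `|d² - 2| ≤ 38/4000`, every `Sq3` pair to `|d² - 3| ≤ 40/4000` and
every `Sq83` pair to `|d² - 8/3| ≤ 60/4000`. [folklore] -/
theorem chart_pins {S : Set (EuclideanSpace ℝ (Fin 3))} {u : EuclideanSpace ℝ (Fin 3)} {adj : Fin 12 → Fin 12 → Prop}
    (hsep : ∀ v ∈ S, dist u v ≤ 13 / 5 → ∀ w ∈ S, w ≠ v → 1 - 1 / 4000 ≤ dist v w ∧ (dist v w ≤ 1 + 1 / 4000 ∨ 131 / 100 ≤ dist v w))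
    (hu : u ∈ S) (idx : {w : EuclideanSpace ℝ (Fin 3) // w ∈ S ∧ w ≠ u ∧ dist u w ≤ 1 + 1 / 400} ≃ Fin 12)
    (hidx : ∀ w w' : {w : EuclideanSpace ℝ (Fin 3) // w ∈ S ∧ w ≠ u ∧ dist u w ≤ 1 + 1 / 400}, w ≠ w' → (dist w.1 w'.1 ≤ 1 + 1 / 400 ↔ adj (idx w) (idx w')))
    (hirr : ∀ i : Fin 12, ¬ adj i i)
    (hsymm : ∀ i j : Fin 12, adj i j → adj j i)
    (hcap : ∀ z₁ ∈ S, ∀ z₂ ∈ S, ∀ z₃ ∈ S, ∀ z₄ ∈ S, z₁ ≠ u → z₂ ≠ u → z₃ ≠ u → z₄ ≠ u → dist u z₁ ≤ 1 + 1 / 4000 → dist u z₂ ≤ 1 + 1 / 4000 → dist u z₃ ≤ 1 + 1 / 4000 → dist u z₄ ≤ 1 + 1 / 4000 → dist z₁ z₂ ≤ 1 + 1 / 4000 → dist z₂ z₃ ≤ 1 + 1 / 4000 → dist z₃ z₄ ≤ 1 + 1 / 4000 → dist z₄ z₁ ≤ 1 + 1 / 4000 → ¬ dist z₁ z₃ ≤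 1 + 1 / 4000 → ¬ dist z₂ z₄ ≤ 1 + 1 / 4000 → ∃ w ∈ S, w ≠ u ∧ dist w z₁ ≤ 1 + 1 / 4000 ∧ dist w z₂ ≤ 1 + 1 / 4000 ∧ dist w z₃ ≤ 1 + 1 / 4000 ∧ dist w z₄ ≤ 1 + 1 / 4000)
    (hoct : ∀ (η : ℝ) (u w z₁ z₂ z₃ z₄ : EuclideanSpace ℝ (Fin 3)), 0 ≤ η → η ≤ 1 / 1000 → 1 - η ≤ dist u z₁ → dist u z₁ ≤ 1 + η → 1 - η ≤ dist u z₂ → dist u z₂ ≤ 1 + η → 1 - η ≤ dist u z₃ → dist u z₃ ≤ 1 + η → 1 - η ≤ dist u z₄ → dist u z₄ ≤ 1 + η → 1 - η ≤ dist w z₁ → dist w z₁ ≤ 1 + η → 1 - η ≤ dist w z₂ → dist w z₂ ≤ 1 + η → 1 - η ≤ dist w z₃ → dist w z₃ ≤ 1 + η → 1 - η ≤ dist w z₄ → dist w z₄ ≤ 1 + η → 1 - η ≤ dist z₁ z₂ → dist z₁ z₂ ≤ 1 + η → 1 - η ≤ dist z₂ z₃ → dist z₂ z₃ ≤ 1 +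 η → 1 - η ≤ dist z₃ z₄ → dist z₃ z₄ ≤ 1 + η → 1 - η ≤ dist z₄ z₁ → dist z₄ z₁ ≤ 1 + η → 131 / 100 ≤ dist z₁ z₃ → 131 / 100 ≤ dist z₂ z₄ → 131 / 100 ≤ dist u w → |dist z₁ z₃ ^ 2 - 2| ≤ 38 * η ∧ |dist z₂ z₄ ^ 2 - 2| ≤ 38 * η ∧ |dist u w ^ 2 - 2| ≤ 29 * η)
    (hlqa : ∀ (η : ℝ) (p c n₁ n₂ n₃ n₄ : EuclideanSpace ℝ (Fin 3)), 0 ≤ η → η ≤ 1 / 1000 → 1 - η ≤ dist c p → dist c p ≤ 1 + η → 1 - η ≤ dist p n₁ → dist p n₁ ≤ 1 + η → 1 - η ≤ dist p n₂ → dist p n₂ ≤ 1 + η → 1 - η ≤ dist p n₃ → dist p n₃ ≤ 1 + η → 1 - η ≤ dist p n₄ → dist p n₄ ≤ 1 + η → 1 - η ≤ dist c n₁ → dist c n₁ ≤ 1 + η → 1 - η ≤ dist c n₂ → dist c n₂ ≤ 1 + η → 1 - η ≤ dist c n₃ → dist c n₃ ≤ 1 + η → 1 - η ≤ dist c n₄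 → dist c n₄ ≤ 1 + η → 1 - η ≤ dist n₁ n₂ → dist n₁ n₂ ≤ 1 + η → 1 - η ≤ dist n₃ n₄ → dist n₃ n₄ ≤ 1 + η → |dist n₂ n₃ ^ 2 - 2| ≤ 38 * η → |dist n₄ n₁ ^ 2 - 2| ≤ 38 * η → 131 / 100 ≤ dist n₁ n₃ → 131 / 100 ≤ dist n₂ n₄ → |dist n₁ n₃ ^ 2 - 3| ≤ 40 * η ∧ |dist n₂ n₄ ^ 2 - 3| ≤ 40 * η)
    (hlqb : ∀ (η : ℝ) (p c n₁ n₂ n₃ n₄ : EuclideanSpace ℝ (Fin 3)), 0 ≤ η → η ≤ 1 / 1000 → 1 - η ≤ dist c p → dist c p ≤ 1 + η → 1 - η ≤ dist p n₁ → dist p n₁ ≤ 1 + η → 1 - η ≤ dist p n₂ → dist p n₂ ≤ 1 + η → 1 - η ≤ dist p n₃ → dist p n₃ ≤ 1 + η → 1 - η ≤ dist p n₄ → dist p n₄ ≤ 1 + η → 1 - η ≤ dist c n₁ → dist c n₁ ≤ 1 + η → 1 - η ≤ dist c n₂ → dist c n₂ ≤ 1 + η → 1 - η ≤ dist c n₃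 → dist c n₃ ≤ 1 + η → 1 - η ≤ dist c n₄ → dist c n₄ ≤ 1 + η → 1 - η ≤ dist n₁ n₂ → dist n₁ n₂ ≤ 1 + η → 1 - η ≤ dist n₂ n₃ → dist n₂ n₃ ≤ 1 + η → |dist n₃ n₄ ^ 2 - 2| ≤ 38 * η → |dist n₄ n₁ ^ 2 - 2| ≤ 38 * η → 131 / 100 ≤ dist n₁ n₃ → 131 / 100 ≤ dist n₂ n₄ → |dist n₁ n₃ ^ 2 - 8 / 3| ≤ 60 * η ∧ |dist n₂ n₄ ^ 2 - 3| ≤ 40 * η)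
    (Sq2 Sq3 Sq83 : Fin 12 → Fin 12 → Prop)
    (fact2 : ∀ i j : Fin 12, Sq2 i j → ∃ k l : Fin 12, adj i k ∧ adj k j ∧ adj j l ∧ adj l i ∧ ¬ adj i j ∧ ¬ adj k l ∧ i ≠ j ∧ k ≠ l)
    (factC : ∀ i j m k : Fin 12, Sq2 i j → adj m i → adj m j → adj k i → adj k j → ¬ adj m k)
    (fact3 : ∀ i j : Fin 12, Sq3 i j → ∃ c k l : Fin 12, (adj c i ∧ adj c k ∧ adj c j ∧ adj c l ∧ adj i k ∧ adj j l ∧ Sq2 k j ∧ Sq2 l i ∧ ¬ adj i j ∧ i ≠ j ∧ ¬ adj k l ∧ k ≠ l) ∨ (adj c k ∧ adj c i ∧ adj c l ∧ adj c j ∧ adj k i ∧ adj i l ∧ Sq2 l j ∧ Sq2 j k ∧ ¬ adj k l ∧ k ≠ l ∧ ¬ adj i j ∧ i ≠ j) ∨ (adj c k ∧ adj c j ∧ adj c l ∧ adj c i ∧ adj k j ∧ adj j l ∧ Sq2 l i ∧ Sq2 i k ∧ ¬ adj k l ∧ k ≠ l ∧ ¬ adj j i ∧ j ≠ i))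
    (fact83 : ∀ i j : Fin 12, Sq83 i j → ∃ c k l : Fin 12, adj c i ∧ adj c k ∧ adj c j ∧ adj c l ∧ adj i k ∧ adj k j ∧ Sq2 j l ∧ Sq2 l i ∧ ¬ adj i j ∧ i ≠ j ∧ ¬ adj k l ∧ k ≠ l) :
    (∀ i j : Fin 12, Sq2 i j → |dist (idx.symm i).1 (idx.symm j).1 ^ 2 - 2| ≤ 38 / 4000) ∧
    (∀ i j : Fin 12, Sq3 i j → |dist (idx.symm i).1 (idx.symm j).1 ^ 2 - 3| ≤ 40 / 4000) ∧
    (∀ i j : Fin 12, Sq83 i j → |dist (idx.symm i).1 (idx.symm j).1 ^ 2 - 8 / 3| ≤ 60 / 4000) := by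
  have H2 : ∀ i j : Fin 12, Sq2 i j → |dist (idx.symm i).1 (idx.symm j).1 ^ 2 - 2| ≤ 38 / 4000 := by
    intro i j hs
    obtain ⟨k, l, hik, hkj, hjl, hli, hij, hkl, hij', hkl'⟩ := fact2 i j hs
    exact chart_sq2_pin hsep hu idx hidx hirr hcap hoct hik hkj hjl hli hij hkl hij' hkl'
      (fun m hmi hmj hmk => factC i j m k hs hmi hmj (hsymm _ _ hik) hkj hmk)
  refine ⟨H2, fun i j hs => ?_, fun i j hs => ?_⟩
  · obtain ⟨c, k, l, hA | hB | hB⟩ := fact3 i j hs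
    · obtain ⟨hc1, hc2, hc3, hc4, h12, h34, s23, s41, h13, h13', h24, h24'⟩ := hA
      exact (chart_linkA_pin hsep hu idx hidx hirr hlqa hc1 hc2 hc3 hc4 h12 h34 (H2 _ _ s23)
        (H2 _ _ s41) h13 h13' h24 h24').1
    · obtain ⟨hc1, hc2, hc3, hc4, h12, h23, s34, s41, h13, h13', h24, h24'⟩ := hB
      exact (chart_linkB_pin hsep hu idx hidx hirr hlqb hc1 hc2 hc3 hc4 h12 h23 (H2 _ _ s34)
        (H2 _ _ s41) h13 h13' h24 h24').2
    · obtain ⟨hc1, hc2, hc3, hc4, h12, h23, s34, s41, h13, h13', h24, h24'⟩ := hB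
      rw [dist_comm]
      exact (chart_linkB_pin hsep hu idx hidx hirr hlqb hc1 hc2 hc3 hc4 h12 h23 (H2 _ _ s34)
        (H2 _ _ s41) h13 h13' h24 h24').2
  · obtain ⟨c, k, l, hc1, hc2, hc3, hc4, h12, h23, s34, s41, h13, h13', h24, h24'⟩ := fact83 i j hs
    exact (chart_linkB_pin hsep hu idx hidx hirr hlqb hc1 hc2 hc3 hc4 h12 h23 (H2 _ _ s34)
      (H2 _ _ s41) h13 h13' h24 h24').1

/-! ## The registered stub -/

/-- **Registered stub `stub_pins` (line `birth`, crux `ZeroDefectDensity`): the pattern pairs of a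
softly kissed shell are pinned.** Under two-shell `1/4000`-soft kissing about `u ∈ S`, with the soft
contact graph of the shell of `u` isomorphic via `e` to the fcc or hcp pattern graph, caps on induced
soft 4-cycles, the squared octahedron lemma and the quantitative link lemma (hypotheses): pattern-`√2`
pairs satisfy `|d² - 2| ≤ 38/4000`, pattern-`√3` pairs `|d² - 3| ≤ 40/4000`, pattern-`√(8/3)` pairs
`|d² - 8/3| ≤ 60/4000`. [folklore] -/
theorem stub_pins : ∀ (S : Set (EuclideanSpace ℝ (Fin 3))) (u : EuclideanSpace ℝ (Fin 3)), u ∈ S → (∀ v ∈ S, dist u v ≤ 13 / 5 → ((∀ w ∈ S, w ≠ v → 1 - 1 / 4000 ≤ dist v w ∧ (dist v w ≤ 1 + 1 / 4000 ∨ 131 / 100 ≤ dist v w)) ∧ {w ∈ S | w ≠ v ∧ dist v w ≤ 1 + 1 / 4000}.ncard = 12)) → ∀ (P : Finset (EuclideanSpace ℝ (Fin 3))), (P = Literature.Geometry.DiscreteGeometry.fccKissingPattern ∨ P = Literature.Geometry.DiscreteGeometry.hcpKissingPattern) → ∀ (e : {w : EuclideanSpace ℝ (Fin 3) // w ∈ S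 ∧ w ≠ u ∧ dist u w ≤ 1 + 1 / 400} ≃ {q : EuclideanSpace ℝ (Fin 3) // q ∈ P}), (∀ w w' : {w : EuclideanSpace ℝ (Fin 3) // w ∈ S ∧ w ≠ u ∧ dist u w ≤ 1 + 1 / 400}, w ≠ w' → (dist w.1 w'.1 ≤ 1 + 1 / 400 ↔ dist (e w).1 (e w').1 = 1)) → (∀ z₁ ∈ S, ∀ z₂ ∈ S, ∀ z₃ ∈ S, ∀ z₄ ∈ S, z₁ ≠ u → z₂ ≠ u → z₃ ≠ u → z₄ ≠ u → dist u z₁ ≤ 1 + 1 / 4000 → dist u z₂ ≤ 1 + 1 / 4000 → dist u z₃ ≤ 1 + 1 / 4000 → dist u z₄ ≤ 1 + 1 / 4000 → dist z₁ z₂ ≤ 1 + 1 / 4000 → dist z₂ z₃ ≤ 1 + 1 / 4000 → dist z₃ z₄ ≤ 1 + 1 / 4000 → dist z₄ z₁ ≤ 1 + 1 / 4000 → ¬ dist z₁ z₃ ≤ 1 + 1 / 4000 → ¬ dist z₂ z₄ ≤ 1 + 1 / 4000 → ∃ w ∈ S, w ≠ u ∧ dist w z₁ ≤ 1 + 1 /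 4000 ∧ dist w z₂ ≤ 1 + 1 / 4000 ∧ dist w z₃ ≤ 1 + 1 / 4000 ∧ dist w z₄ ≤ 1 + 1 / 4000) → (∀ (η : ℝ) (u w z₁ z₂ z₃ z₄ : EuclideanSpace ℝ (Fin 3)), 0 ≤ η → η ≤ 1 / 1000 → 1 - η ≤ dist u z₁ → dist u z₁ ≤ 1 + η → 1 - η ≤ dist u z₂ → dist u z₂ ≤ 1 + η → 1 - η ≤ dist u z₃ → dist u z₃ ≤ 1 + η → 1 - η ≤ dist u z₄ → dist u z₄ ≤ 1 + η → 1 - η ≤ dist w z₁ → dist w z₁ ≤ 1 + η → 1 - η ≤ dist w z₂ → dist w z₂ ≤ 1 + η → 1 - η ≤ dist w z₃ → dist w z₃ ≤ 1 + η → 1 - η ≤ dist w z₄ → dist w z₄ ≤ 1 + η → 1 - η ≤ dist z₁ z₂ → dist z₁ z₂ ≤ 1 + η → 1 - η ≤ dist z₂ z₃ → dist z₂ z₃ ≤ 1 + η → 1 - η ≤ dist z₃ z₄ → dist z₃ z₄ ≤ 1 + η → 1 - η ≤ dist z₄ z₁ → dist z₄ z₁ ≤ 1 + η → 131 / 100 ≤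 dist z₁ z₃ → 131 / 100 ≤ dist z₂ z₄ → 131 / 100 ≤ dist u w → |dist z₁ z₃ ^ 2 - 2| ≤ 38 * η ∧ |dist z₂ z₄ ^ 2 - 2| ≤ 38 * η ∧ |dist u w ^ 2 - 2| ≤ 29 * η) → (∀ (η : ℝ) (p c n₁ n₂ n₃ n₄ : EuclideanSpace ℝ (Fin 3)), 0 ≤ η → η ≤ 1 / 1000 → 1 - η ≤ dist c p → dist c p ≤ 1 + η → 1 - η ≤ dist p n₁ → dist p n₁ ≤ 1 + η → 1 - η ≤ dist p n₂ → dist p n₂ ≤ 1 + η → 1 - η ≤ dist p n₃ → dist p n₃ ≤ 1 + η → 1 - η ≤ dist p n₄ → dist p n₄ ≤ 1 + η → 1 - η ≤ dist c n₁ → dist c n₁ ≤ 1 + η → 1 - η ≤ dist c n₂ → dist c n₂ ≤ 1 + η → 1 - η ≤ dist c n₃ → dist c n₃ ≤ 1 + η → 1 - η ≤ dist c n₄ → dist c n₄ ≤ 1 + η → 1 - η ≤ dist n₁ n₂ → dist n₁ n₂ ≤ 1 + η → 1 - η ≤ dist n₃ n₄ → dist n₃ n₄ ≤ 1 + η → |dist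 n₂ n₃ ^ 2 - 2| ≤ 38 * η → |dist n₄ n₁ ^ 2 - 2| ≤ 38 * η → 131 / 100 ≤ dist n₁ n₃ → 131 / 100 ≤ dist n₂ n₄ → |dist n₁ n₃ ^ 2 - 3| ≤ 40 * η ∧ |dist n₂ n₄ ^ 2 - 3| ≤ 40 * η) → (∀ (η : ℝ) (p c n₁ n₂ n₃ n₄ : EuclideanSpace ℝ (Fin 3)), 0 ≤ η → η ≤ 1 / 1000 → 1 - η ≤ dist c p → dist c p ≤ 1 + η → 1 - η ≤ dist p n₁ → dist p n₁ ≤ 1 + η → 1 - η ≤ dist p n₂ → dist p n₂ ≤ 1 + η → 1 - η ≤ dist p n₃ → dist p n₃ ≤ 1 + η → 1 - η ≤ dist p n₄ → dist p n₄ ≤ 1 + η → 1 - η ≤ dist c n₁ → dist c n₁ ≤ 1 + η → 1 - η ≤ dist c n₂ → dist c n₂ ≤ 1 + η → 1 - η ≤ dist c n₃ → dist c n₃ ≤ 1 + η → 1 - η ≤ dist c n₄ → dist c n₄ ≤ 1 + η → 1 - η ≤ dist n₁ n₂ → dist n₁ n₂ ≤ 1 + η → 1 - η ≤ dist n₂ n₃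 → dist n₂ n₃ ≤ 1 + η → |dist n₃ n₄ ^ 2 - 2| ≤ 38 * η → |dist n₄ n₁ ^ 2 - 2| ≤ 38 * η → 131 / 100 ≤ dist n₁ n₃ → 131 / 100 ≤ dist n₂ n₄ → |dist n₁ n₃ ^ 2 - 8 / 3| ≤ 60 * η ∧ |dist n₂ n₄ ^ 2 - 3| ≤ 40 * η) → ((∀ t t' : {w : EuclideanSpace ℝ (Fin 3) // w ∈ S ∧ w ≠ u ∧ dist u w ≤ 1 + 1 / 400}, dist (e t).1 (e t').1 = Real.sqrt 2 → |dist t.1 t'.1 ^ 2 - 2| ≤ 38 / 4000) ∧ (∀ t t' : {w : EuclideanSpace ℝ (Fin 3) // w ∈ S ∧ w ≠ u ∧ dist u w ≤ 1 + 1 / 400}, dist (e t).1 (e t').1 = Real.sqrt 3 → |dist t.1 t'.1 ^ 2 - 3| ≤ 40 / 4000) ∧ (∀ t t' : {w : EuclideanSpace ℝ (Fin 3) // w ∈ S ∧ w ≠ u ∧ dist u w ≤ 1 + 1 / 400}, dist (e t).1 (e t').1 = Real.sqrt (8 / 3) → |dist t.1 t'.1 ^ 2 - 8 / 3| ≤ 60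 / 4000)) := by
  intro S u hu hTS P hP e hISO hCAPS hOCT hLQA hLQB
  have hsep : ∀ v ∈ S, dist u v ≤ 13 / 5 → ∀ w ∈ S, w ≠ v →
      1 - 1 / 4000 ≤ dist v w ∧ (dist v w ≤ 1 + 1 / 4000 ∨ 131 / 100 ≤ dist v w) :=
    fun v hv hd => (hTS v hv hd).1
  rcases hP with rfl | rfl
  · -- the fcc pattern
    obtain ⟨f, hf1, hf2, hf3, hf83⟩ := fcc_chart_full
    have hidx : ∀ w w' : {w : EuclideanSpace ℝ (Fin 3) // w ∈ S ∧ w ≠ u ∧ dist u w ≤ 1 + 1 / 400}, w ≠ w' →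
        (dist w.1 w'.1 ≤ 1 + 1 / 400 ↔ fccAdj ((e.trans f.symm) w) ((e.trans f.symm) w')) := by
      intro w w' hne
      rw [hISO w w' hne, Equiv.trans_apply, Equiv.trans_apply, ← hf1, Equiv.apply_symm_apply,
        Equiv.apply_symm_apply]
    have K := chart_pins hsep hu (e.trans f.symm) hidx fcc_adj_irrefl fcc_adj_symm hCAPS hOCT hLQA hLQB
      (fun i j => sqNormInt (fccTab i - fccTab j) = 4) (fun i j => sqNormInt (fccTab i - fccTab j) = 6)
      (fun _ _ => False) fcc_sq2_square fcc_sq2_common fcc_sq3_link (fun i j h => h.elim)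
    have hfe : ∀ t t' : {w : EuclideanSpace ℝ (Fin 3) // w ∈ S ∧ w ≠ u ∧ dist u w ≤ 1 + 1 / 400},
        dist (f ((e.trans f.symm) t)).1 (f ((e.trans f.symm) t')).1 = dist (e t).1 (e t').1 := by
      intro t t'
      rw [Equiv.trans_apply, Equiv.trans_apply, Equiv.apply_symm_apply, Equiv.apply_symm_apply]
    refine ⟨fun t t' h => ?_, fun t t' h => ?_, fun t t' h => ?_⟩
    · have h' := K.1 ((e.trans f.symm) t) ((e.trans f.symm) t') (hf2 _ _ (by rw [hfe]; exact h))
      rwa [Equiv.symm_apply_apply, Equiv.symm_apply_apply] at h'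
    · have h' := K.2.1 ((e.trans f.symm) t) ((e.trans f.symm) t') (hf3 _ _ (by rw [hfe]; exact h))
      rwa [Equiv.symm_apply_apply, Equiv.symm_apply_apply] at h'
    · exact absurd ((hfe t t').trans h) (hf83 _ _)
  · -- the hcp pattern
    obtain ⟨f, hf1, hf2, hf3, hf83⟩ := hcp_chart_full
    have hidx : ∀ w w' : {w : EuclideanSpace ℝ (Fin 3) // w ∈ S ∧ w ≠ u ∧ dist u w ≤ 1 + 1 / 400}, w ≠ w' →
        (dist w.1 w'.1 ≤ 1 + 1 / 400 ↔ hcpAdj ((e.trans f.symm) w) ((e.trans f.symm) w')) := by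
      intro w w' hne
      rw [hISO w w' hne, Equiv.trans_apply, Equiv.trans_apply, ← hf1, Equiv.apply_symm_apply,
        Equiv.apply_symm_apply]
    have K := chart_pins hsep hu (e.trans f.symm) hidx hcp_adj_irrefl hcp_adj_symm hCAPS hOCT hLQA hLQB
      (fun i j => sqNormInt (hcpTab i - hcpTab j) = 36) (fun i j => sqNormInt (hcpTab i - hcpTab j) = 54)
      (fun i j => sqNormInt (hcpTab i - hcpTab j) = 48) hcp_sq2_square hcp_sq2_common hcp_sq3_link
      hcp_sq83_link
    have hfe : ∀ t t' : {w : EuclideanSpace ℝ (Fin 3) // w ∈ S ∧ w ≠ u ∧ dist u w ≤ 1 + 1 / 400},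
        dist (f ((e.trans f.symm) t)).1 (f ((e.trans f.symm) t')).1 = dist (e t).1 (e t').1 := by
      intro t t'
      rw [Equiv.trans_apply, Equiv.trans_apply, Equiv.apply_symm_apply, Equiv.apply_symm_apply]
    refine ⟨fun t t' h => ?_, fun t t' h => ?_, fun t t' h => ?_⟩
    · have h' := K.1 ((e.trans f.symm) t) ((e.trans f.symm) t') (hf2 _ _ (by rw [hfe]; exact h))
      rwa [Equiv.symm_apply_apply, Equiv.symm_apply_apply] at h'
    · have h' := K.2.1 ((e.trans f.symm) t) ((e.trans f.symm) t') (hf3 _ _ (by rw [hfe]; exact h))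
      rwa [Equiv.symm_apply_apply, Equiv.symm_apply_apply] at h'
    · have h' := K.2.2 ((e.trans f.symm) t) ((e.trans f.symm) t') (hf83 _ _ (by rw [hfe]; exact h))
      rwa [Equiv.symm_apply_apply, Equiv.symm_apply_apply] at h'

end Summit.AtomisticToContinuum.Crystallization.Theorems.ZeroDefectDensityBirth
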